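import Mathlib
import Summits.NavierStokesRegularity.NavierStokesRegularity.Theses.FrozenSignCascade
import Summits.NavierStokesRegularity.NavierStokesRegularity.Theorems.FrozenSignCascadeEnvelopeBoundShellSmallness
import HarnessLib

/-!
# Route FrozenSignCascade · crux `EnvelopeBound` (stmt-NavierStokesRegularity-1549): the crux from
  tightness at ONE fixed relative level beyond an a-priori radius

Support file for the crux item stmt-NavierStokesRegularity-1549 (`EnvelopeBound`); lands `--supports`
that item (line `registered`, lead c1). It packages the frequency localisation
`Registered.envelopeBound_of_shellSmallness` as a citeable REDUCTION of the crux: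

**Theorem (`envelopeBound_of_tightAtLevel`).** There is an absolute constant `κ > 0` (the one of
`envelopeBound_of_shellSmallness`, `= 1/6912` there) such that the crux `EnvelopeBound` follows from
the statement: *for every `ν > 0`, Clay datum `u₀` and horizon `T₀ > 0` there is an a-priori radius
`R = R(ν,u₀,T₀) ≥ 1` beyond which the critical envelope of EVERY Fourier-mild solution `V` on
`[0,T]`, `T ≤ T₀`, from the Fourier datum stays below `κν`:
`‖ξ‖ ≥ R ⇒ ‖ξ‖² ‖V t ξ‖ ≤ κ ν`.*

So a line for the crux need only produce ONE fixed level of smallness (`ν/6912`) of the envelope at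
high frequencies, uniformly over solutions and horizons `T ≤ T₀`, beyond a radius it may choose from
`(ν,u₀,T₀)` — and by `envelopeBound_of_shellSmallness` even only on the bounded shell
`R ≤ ‖ξ‖ ≤ R'(ν,u₀,T₀,R)`. Physically `R` must lie beyond the dissipation wavenumbers reached before
`T₀`; the route's sign mechanism has to supply exactly this a-priori `R`.
-/

noncomputable section

set_option linter.dupNamespace false -- nested layout Summit.<S>.<Sub>, Sub = S (D-0017)

open Set
open Literature.Analysis.FluidPDE Literature.Analysis.FluidPDE.FourierNS

namespace Summit.NavierStokesRegularity.NavierStokesRegularity.Theorems.EnvelopeBound.Registered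

/-- **The crux from `κν`-tightness beyond an a-priori radius.** There is an absolute `κ > 0` such
that: if for every `ν > 0`, Clay datum `u₀` and horizon `T₀ > 0` there is `R ≥ 1` with
`‖ξ‖² ‖V t ξ‖ ≤ κ ν` for all `‖ξ‖ ≥ R`, `t ∈ [0,T]`, along every Fourier-mild solution `V` on `[0,T]`,
`T ≤ T₀`, from the Fourier datum, then `EnvelopeBound` holds (instantiate the shell theorem
`envelopeBound_of_shellSmallness` at that `R`; its shell hypothesis is implied by the tightness). -/
theorem envelopeBound_of_tightAtLevel :
    ∃ κ : ℝ, 0 < κ ∧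
      ((∀ ν : ℝ, 0 < ν →
        ∀ (u₀ : EuclideanSpace ℝ (Fin 3) → EuclideanSpace ℝ (Fin 3)) (hu : ContDiff ℝ (⊤ : ℕ∞) u₀)
          (hd : Literature.Analysis.FluidPDE.HasRapidSpatialDecay u₀),
          Literature.Analysis.FluidPDE.NSWave0.IsDivFree u₀ →
        ∀ T₀ : ℝ, 0 < T₀ → ∃ R : ℝ, 1 ≤ R ∧
          ∀ T : ℝ, T ≤ T₀ → ∀ V : ℝ → EuclideanSpace ℝ (Fin 3) → Fin 3 → ℂ,
            Literature.Analysis.FluidPDE.FourierNS.IsFourierMild (4 * Real.pi ^ 2 * ν) 4 0 T V →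
            V 0 = Literature.Analysis.FluidPDE.FourierNS.fourierData hu hd →
            ∀ t ∈ Set.Icc 0 T, ∀ ξ : EuclideanSpace ℝ (Fin 3), R ≤ ‖ξ‖ →
              ‖ξ‖ ^ 2 * ‖V t ξ‖ ≤ κ * ν) →
      Summit.NavierStokesRegularity.NavierStokesRegularity.Theses.FrozenSignCascade.EnvelopeBound) := by
  obtain ⟨κ, hκ, hshell⟩ := envelopeBound_of_shellSmallness
  refine ⟨κ, hκ, fun htight => ?_⟩
  intro ν hν u₀ hu hd hdiv T₀ hT₀
  obtain ⟨R, hR1, hRt⟩ := htight ν hν u₀ hu hd hdiv T₀ hT₀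
  obtain ⟨R', C, -, hC⟩ := hshell ν hν u₀ hu hd hdiv T₀ hT₀ R hR1
  exact ⟨C, fun T hT V hV hV0 t ht ξ =>
    hC T hT V hV hV0 (fun s hs ζ hζ _ => hRt T hT V hV hV0 s hs ζ hζ) t ht ξ⟩

end Summit.NavierStokesRegularity.NavierStokesRegularity.Theorems.EnvelopeBound.Registered

end
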